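import Literature.Analysis.FluidPDE.WeylLemmaPoissonBall
import Literature.Analysis.FluidPDE.WholeSpaceIBP
import Literature.Analysis.FluidPDE.SecondDifferenceLaplacian
import HarnessLib

/-!
# Continuous functions with `o(h²)` stencil are harmonic (Weyl's lemma, discrete converse of the mean value property)

Analysis/FluidPDE support file (theorems only: no definitions, no named facts) on `ℝ³`.

* `harmonicOnNhd_of_continuousOn_of_weaklyHarmonic` — a function continuous on an open set
  `V ⊆ ℝ³` and weakly harmonic there (`∫ g Δφ = 0` for all `φ ∈ C_c^∞(V)`) is harmonic on `V`
  in Mathlib's sense (`InnerProductSpace.HarmonicOnNhd`): the tree's Weyl lemma on balls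
  (`WeylLemmaBall.exists_contDiff_rep_of_weakPoisson_ball`) gives a smooth a.e.-representative,
  which agrees with `g` everywhere by continuity and is pointwise harmonic by Green's second
  identity, the fundamental lemma of the calculus of variations and continuity of its Laplacian.
* `harmonicOnNhd_of_abs_stencil_le` — if moreover only the `7`-point stencil of `g` is known to
  be `o(h²)` uniformly on compact subsets of `V` (for some orthonormal frame), then `g` is weakly
  harmonic, hence harmonic: summation by parts moves the stencil onto the test function, where
  `h⁻² · stencil → Δφ` uniformly (`abs_stencil_sub_laplacian_le`, uniform continuity of `D²φ`).
  This is the form in which discrete null vectors of reflection-positive HARMONIC kernels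
  (Cauchy–Schwarz in an Osterwalder–Schrader space) produce harmonic correlation functions.
* helpers: `integral_mul_comp_add_eq_of_tsupport`,
  `harmonicAt_comp_sub_const` (harmonicity is transported by translations).

## References

* H. Weyl, *The method of orthogonal projection in potential theory*, Duke Math. J. 7 (1940), Lemma 2.
* D. Gilbarg, N. S. Trudinger, *Elliptic Partial Differential Equations of Second Order* (2001),
  §2.3. [`GilbargTrudinger2001`]
-/

noncomputable section

open MeasureTheory Set Function Filter Topology TopologicalSpace Metric InnerProductSpace
open scoped Topology Laplacian

namespace Literature.Analysis.FluidPDE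

section SmallStencil

/-- Local notation for physical space `ℝ³ = EuclideanSpace ℝ (Fin 3)`. -/
local notation "ℝ³" => EuclideanSpace ℝ (Fin 3)

/-- The product of a function continuous on an open set `V` with a continuous function whose
topological support lies in `V` is continuous on the whole space (file-local copy of a tree
helper, kept private to avoid a heavier import). [folklore] -/
private theorem continuous_mul_of_tsupport_subset_aux {X : Type*} [TopologicalSpace X] {V : Set X}
    (hV : IsOpen V) {g φ : X → ℝ} (hg : ContinuousOn g V) (hφ : Continuous φ)
    (hsub : tsupport φ ⊆ V) : Continuous fun x => g x * φ x := by
  rw [continuous_iff_continuousAt]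
  intro x
  by_cases hx : x ∈ V
  · exact ((hg x hx).continuousAt (hV.mem_nhds hx)).mul hφ.continuousAt
  · have hx' : x ∉ tsupport φ := fun h => hx (hsub h)
    have : (fun _ => (0:ℝ)) =ᶠ[𝓝 x] fun y => g y * φ y := by
      filter_upwards [(isClosed_tsupport φ).isOpen_compl.mem_nhds hx'] with y hy
      rw [image_eq_zero_of_notMem_tsupport hy, mul_zero]
    exact continuousAt_const.congr this

/-- **A continuous weakly harmonic function is harmonic** (Weyl's lemma plus continuity). If `g`
is continuous on the open set `V ⊆ ℝ³` and `∫ g Δφ = 0` for every `φ ∈ C_c^∞` with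
`tsupport φ ⊆ V`, then `g` is harmonic on `V` in Mathlib's sense (`InnerProductSpace.HarmonicAt`
at every point). Proof: on a ball `B ⊂⊂ V`, the tree's Weyl lemma
(`WeylLemmaBall.exists_contDiff_rep_of_weakPoisson_ball`, source `0`) gives a smooth `g'` with
`g = g'` a.e. on a smaller ball, hence everywhere there (both continuous); `g'` is weakly
harmonic there, so `Δg' = 0` (Green's second identity `integral_mul_laplacian_comm`, the
fundamental lemma of the calculus of variations, continuity of `Δg'`).
[cite: GilbargTrudinger2001, §2.3 (Weyl's lemma)] -/
theorem harmonicOnNhd_of_continuousOn_of_weaklyHarmonic {V : Set ℝ³} (hV : IsOpen V)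
    {g : ℝ³ → ℝ} (hg : ContinuousOn g V)
    (hweak : ∀ φ : ℝ³ → ℝ, ContDiff ℝ (⊤ : ℕ∞) φ → HasCompactSupport φ → tsupport φ ⊆ V →
      ∫ x, g x * (Δ φ) x = 0) :
    HarmonicOnNhd g V := by
  intro x₀ hx₀
  obtain ⟨R, hR, hball⟩ : ∃ R > 0, closedBall x₀ R ⊆ V :=
    (nhds_basis_closedBall.mem_iff).1 (hV.mem_nhds hx₀)
  have hgi : IntegrableOn g (ball x₀ R) volume :=
    ((hg.mono hball).integrableOn_compact (isCompact_closedBall _ _)).mono_set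
      ball_subset_closedBall
  have hweak' : ∀ φ : ℝ³ → ℝ,
      FunctionSpaces.IsTestFunctionOn (⟨ball x₀ R, isOpen_ball⟩ : Opens ℝ³) φ →
        ∫ x in ball x₀ R, g x * (Δ φ) x = ∫ x in ball x₀ R, (0 : ℝ³ → ℝ) x * φ x := by
    intro φ hφ
    simp only [Pi.zero_apply, zero_mul, integral_zero]
    have hsub : tsupport φ ⊆ ball x₀ R := hφ.tsupport_subset
    rw [setIntegral_eq_integral_of_forall_compl_eq_zero fun x hx => ?_]
    · exact hweak φ hφ.contDiff hφ.hasCompactSupport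
        (hsub.trans (ball_subset_closedBall.trans hball))
    · rw [laplacian_eq_zero_of_notMem_tsupport (fun h => hx (hsub h)), mul_zero]
  obtain ⟨g', hg's, hae⟩ := WeylLemmaBall.exists_contDiff_rep_of_weakPoisson_ball
    (r₁ := R / 2) (half_pos hR) hgi contDiff_zero_fun hweak'
  set W : Set ℝ³ := ball x₀ (R - R / 2) with hW
  have hWo : IsOpen W := isOpen_ball
  have hx₀W : x₀ ∈ W := mem_ball_self (by linarith)
  have hWV : W ⊆ V :=
    (ball_subset_ball (by linarith)).trans (ball_subset_closedBall.trans hball)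
  have heq : EqOn g g' W :=
    Measure.eqOn_open_of_ae_eq hae hWo (hg.mono hWV) hg's.continuous.continuousOn
  have hg'2 : ContDiff ℝ 2 g' := hg's.of_le (by norm_cast)
  -- `Δ g' = 0` on `W`
  have hΔc : Continuous (Δ g') := continuous_laplacian hg'2
  have hw2 : ∀ φ : ℝ³ → ℝ, ContDiff ℝ (⊤ : ℕ∞) φ → HasCompactSupport φ → tsupport φ ⊆ W →
      ∫ x, φ x * (Δ g') x = 0 := by
    intro φ hφ hφc hφs
    rw [integral_mul_laplacian_comm hg'2 (hφ.of_le (by norm_cast)) hφc]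
    have : (fun x => (Δ φ) x * g' x) = fun x => g x * (Δ φ) x := by
      funext x
      by_cases hx : x ∈ W
      · rw [heq hx, mul_comm]
      · rw [laplacian_eq_zero_of_notMem_tsupport (fun h => hx (hφs h)), zero_mul, mul_zero]
    rw [this]
    exact hweak φ hφ hφc (hφs.trans hWV)
  have hae0 : ∀ᵐ x ∂volume, x ∈ W → (Δ g') x = 0 :=
    hWo.ae_eq_zero_of_integral_contDiff_smul_eq_zero
      (hΔc.locallyIntegrable.locallyIntegrableOn W)
      (fun φ hφ hφc hφs => by simpa only [smul_eq_mul] using hw2 φ hφ hφc hφs)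
  have hΔg' : EqOn (Δ g') 0 W := by
    refine Measure.eqOn_open_of_ae_eq (μ := volume) ?_ hWo hΔc.continuousOn continuousOn_const
    rw [EventuallyEq, ae_restrict_iff' hWo.measurableSet]
    exact hae0
  -- conclusion
  have hgg' : g =ᶠ[𝓝 x₀] g' := Filter.eventuallyEq_of_mem (hWo.mem_nhds hx₀W) heq
  refine ⟨hg'2.contDiffAt.congr_of_eventuallyEq hgg', ?_⟩
  filter_upwards [laplacian_congr_nhds hgg', hWo.mem_nhds hx₀W] with x hx hxW
  rw [hx, hΔg' hxW]

variable {ι : Type*} [Fintype ι]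

/-- **Summation by parts for the stencil against a test function.** If `g` is continuous on the
open set `V`, `φ` is continuous with `cthickening δ (tsupport φ) ⊆ V`, and `‖c‖ ≤ δ`, then
`∫ g(x) φ(x + c) dx = ∫ g(x - c) φ(x) dx`, all integrands being continuous with compact support
(translation invariance of Lebesgue measure). [folklore] -/
theorem integral_mul_comp_add_eq_of_tsupport {V : Set ℝ³} (hV : IsOpen V) {g φ : ℝ³ → ℝ}
    (hg : ContinuousOn g V) (hφ : Continuous φ) (hφc : HasCompactSupport φ) {δ : ℝ}
    (hδV : cthickening δ (tsupport φ) ⊆ V) {c : ℝ³} (hc : ‖c‖ ≤ δ) :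
    Integrable (fun x => g (x - c) * φ x) ∧ Integrable (fun x => g x * φ (x + c)) ∧
      ∫ x, g x * φ (x + c) = ∫ x, g (x - c) * φ x := by
  have hcont : Continuous fun x => g (x - c) * φ x := by
    refine continuous_mul_of_tsupport_subset_aux (V := (fun x => x - c) ⁻¹' V)
      (hV.preimage (continuous_id.sub continuous_const))
      (hg.comp (continuous_id.sub continuous_const).continuousOn fun x hx => hx) hφ ?_
    intro x hx
    exact hδV (mem_cthickening_of_dist_le (x - c) x δ _ hx (by simpa [dist_eq_norm] using hc))
  have hI : Integrable (fun x => g (x - c) * φ x) :=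
    hcont.integrable_of_hasCompactSupport hφc.mul_left
  have hI2 : Integrable (fun x => g x * φ (x + c)) := by
    simpa only [add_sub_cancel_right] using hI.comp_add_right c
  refine ⟨hI, hI2, ?_⟩
  have := integral_add_right_eq_self (μ := volume) (fun x => g (x - c) * φ x) c
  simpa only [add_sub_cancel_right] using this

/-- **Continuous functions with `o(h²)` stencil are harmonic** (a discrete converse of the mean
value property). Let `g` be continuous on the open set `V ⊆ ℝ³` and suppose that for every
compact `K ⊆ V` the `7`-point stencil `Σᵢ (g(x + h bᵢ) + g(x - h bᵢ) - 2g(x))` (any orthonormal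
basis `b`) is `≤ ε h²` in absolute value uniformly for `x ∈ K` and small `h`, for every `ε > 0`.
Then `g` is harmonic on `V`. Proof: for a test function `φ`, summation by parts gives
`∫ g · (stencil of φ) = ∫ (stencil of g) · φ = o(h²)`, while `h⁻² (stencil of φ) → Δφ`
uniformly (`abs_stencil_sub_laplacian_le` and uniform continuity of `D²φ`); hence `∫ g Δφ = 0`
and `harmonicOnNhd_of_continuousOn_of_weaklyHarmonic` applies. [folklore] -/
theorem harmonicOnNhd_of_abs_stencil_le (b : OrthonormalBasis ι ℝ ℝ³) {V : Set ℝ³}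
    (hV : IsOpen V) {g : ℝ³ → ℝ} (hg : ContinuousOn g V)
    (hst : ∀ K ⊆ V, IsCompact K → ∀ ε : ℝ, 0 < ε → ∃ h₀ : ℝ, 0 < h₀ ∧ ∀ x ∈ K, ∀ h : ℝ,
      0 < h → h < h₀ → |∑ i, (g (x + h • b i) + g (x - h • b i) - 2 * g x)| ≤ ε * h ^ 2) :
    HarmonicOnNhd g V := by
  refine harmonicOnNhd_of_continuousOn_of_weaklyHarmonic hV hg fun φ hφ hφc hφV => ?_
  have hK0 : IsCompact (tsupport φ) := hφc
  obtain ⟨δ, hδ, hKV⟩ := hK0.exists_cthickening_subset_open hV hφV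
  set K : Set ℝ³ := cthickening δ (tsupport φ) with hKdef
  have hK : IsCompact K := hK0.cthickening
  have hsubK : tsupport φ ⊆ K := self_subset_cthickening _
  obtain ⟨M₀, hM₀⟩ := hK.exists_bound_of_continuousOn (hg.mono hKV)
  set M : ℝ := max M₀ 0 with hMdef
  have hM0 : 0 ≤ M := le_max_right _ _
  have hM : ∀ x ∈ K, |g x| ≤ M := fun x hx =>
    (le_of_eq (Real.norm_eq_abs _).symm).trans ((hM₀ x hx).trans (le_max_left _ _))
  have hφ2 : ContDiff ℝ 2 φ := hφ.of_le (by norm_cast)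
  have hφi : Integrable φ := hφ.continuous.integrable_of_hasCompactSupport hφc
  have hD2u : UniformContinuous (iteratedFDeriv ℝ 2 φ) :=
    (hφc.iteratedFDeriv 2).uniformContinuous_of_continuous (hφ2.continuous_iteratedFDeriv le_rfl)
  have hn1 : ∀ i, ‖b i‖ = 1 := fun i => b.orthonormal.1 i
  -- `Δφ` is continuous with support in `tsupport φ`
  have hΔφc : Continuous (Δ φ) := continuous_laplacian hφ2
  have hΔφ0 : ∀ x, x ∉ tsupport φ → (Δ φ) x = 0 := fun x hx => laplacian_eq_zero_of_notMem_tsupport hx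
  have hIΔ : Integrable (fun x => g x * (Δ φ) x) := by
    refine (continuous_mul_of_tsupport_subset_aux hV hg hΔφc ?_).integrable_of_hasCompactSupport ?_
    · exact (closure_minimal (fun x hx => not_not.1 (mt (hΔφ0 x) hx))
        (isClosed_tsupport φ)).trans hφV
    · exact HasCompactSupport.mul_left (hφc.mono' fun x hx => not_not.1 (mt (hΔφ0 x) hx))
  set A : ℝ := ∫ x, g x * (Δ φ) x with hA
  set C₀ : ℝ := 2 * Fintype.card ι * M * volume.real K + ∫ x, |φ x| with hC₀
  have hφabs : 0 ≤ ∫ x, |φ x| := integral_nonneg fun x => abs_nonneg _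
  have hC₀0 : 0 ≤ C₀ := by positivity
  -- points at distance `≤ δ` from outside `K` are outside `tsupport φ`
  have hout : ∀ x, x ∉ K → ∀ v : ℝ³, ‖v‖ ≤ δ → φ (x + v) = 0 := by
    intro x hx v hv
    refine image_eq_zero_of_notMem_tsupport fun hmem => hx ?_
    exact mem_cthickening_of_dist_le x (x + v) δ _ hmem (by simpa [dist_eq_norm] using hv)
  -- the key estimate: `|A| ≤ ε C₀` for every `ε > 0`
  have key : ∀ ε : ℝ, 0 < ε → |A| ≤ ε * C₀ := by
    intro ε hε
    obtain ⟨h₁, hh₁, hst₁⟩ := hst K hKV hK ε hε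
    obtain ⟨h₂, hh₂, hD2⟩ := Metric.uniformContinuous_iff.1 hD2u ε hε
    set h : ℝ := min (min h₁ h₂) δ / 2 with hh
    have hh0 : 0 < h := by positivity
    have hmin : min (min h₁ h₂) δ ≤ h₁ ∧ min (min h₁ h₂) δ ≤ h₂ ∧ min (min h₁ h₂) δ ≤ δ :=
      ⟨(min_le_left _ _).trans (min_le_left _ _), (min_le_left _ _).trans (min_le_right _ _),
        min_le_right _ _⟩
    have hhh₁ : h < h₁ := by rw [hh]; linarith [hmin.1, lt_min (lt_min hh₁ hh₂) hδ]
    have hhh₂ : h < h₂ := by rw [hh]; linarith [hmin.2.1, lt_min (lt_min hh₁ hh₂) hδ]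
    have hhδ : h ≤ δ := by rw [hh]; linarith [hmin.2.2, lt_min (lt_min hh₁ hh₂) hδ]
    have hhb : ∀ i, ‖h • b i‖ ≤ δ := fun i => by
      rw [norm_smul, hn1, mul_one, Real.norm_eq_abs, abs_of_pos hh0]; exact hhδ
    -- translated integrals
    have P := fun i => integral_mul_comp_add_eq_of_tsupport hV hg hφ.continuous hφc hKV (hhb i)
    have N := fun i => integral_mul_comp_add_eq_of_tsupport hV hg hφ.continuous hφc hKV
      (c := -(h • b i)) (by rw [norm_neg]; exact hhb i)
    simp only [sub_neg_eq_add, ← sub_eq_add_neg] at N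
    have I0 := integral_mul_comp_add_eq_of_tsupport hV hg hφ.continuous hφc hKV (c := 0)
      (by simp [hδ.le])
    have hI : Integrable (fun x => g x * φ x) := by simpa using I0.1
    -- (4) summation by parts
    set L : ι → ℝ³ → ℝ := fun i x =>
      g x * φ (x + h • b i) + g x * φ (x - h • b i) - 2 * (g x * φ x) with hL
    set Rr : ι → ℝ³ → ℝ := fun i x =>
      g (x + h • b i) * φ x + g (x - h • b i) * φ x - 2 * (g x * φ x) with hRr
    have lhs : ∀ x, g x * (∑ i, (φ (x + h • b i) + φ (x - h • b i) - 2 * φ x)) =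
        ∑ i, L i x := fun x => by
      rw [Finset.mul_sum]; refine Finset.sum_congr rfl fun i _ => ?_; rw [hL]; ring
    have rhs : ∀ x, (∑ i, (g (x + h • b i) + g (x - h • b i) - 2 * g x)) * φ x =
        ∑ i, Rr i x := fun x => by
      rw [Finset.sum_mul]; refine Finset.sum_congr rfl fun i _ => ?_; rw [hRr]; ring
    have hIL : ∀ i, Integrable (L i) := fun i =>
      ((P i).2.1.add (N i).2.1).sub (hI.const_mul 2)
    have hIR : ∀ i, Integrable (Rr i) := fun i =>
      ((N i).1.add (P i).1).sub (hI.const_mul 2)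
    have sbp : ∫ x, g x * (∑ i, (φ (x + h • b i) + φ (x - h • b i) - 2 * φ x)) =
        ∫ x, (∑ i, (g (x + h • b i) + g (x - h • b i) - 2 * g x)) * φ x := by
      simp_rw [lhs, rhs]
      rw [integral_finsetSum _ (fun i _ => hIL i), integral_finsetSum _ (fun i _ => hIR i)]
      refine Finset.sum_congr rfl fun i _ => ?_
      simp only [hL, hRr]
      have hA1 : Integrable (fun x => g x * φ (x + h • b i) + g x * φ (x - h • b i)) :=
        (P i).2.1.add (N i).2.1
      have hA2 : Integrable (fun x => g (x + h • b i) * φ x + g (x - h • b i) * φ x) :=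
        (N i).1.add (P i).1
      have hA3 : Integrable (fun x => 2 * (g x * φ x)) := hI.const_mul 2
      rw [integral_sub hA1 hA3, integral_add (P i).2.1 (N i).2.1, integral_sub hA2 hA3,
        integral_add (N i).1 (P i).1, (P i).2.2, (N i).2.2]
      ring
    -- (5) `|∫ (stencil of g) φ| ≤ ε h² ∫ |φ|`
    have e5 : |∫ x, (∑ i, (g (x + h • b i) + g (x - h • b i) - 2 * g x)) * φ x| ≤
        ε * h ^ 2 * ∫ x, |φ x| := by
      rw [← integral_const_mul, ← Real.norm_eq_abs]
      refine norm_integral_le_of_norm_le (hφi.abs.const_mul _) (ae_of_all _ fun x => ?_)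
      rw [Real.norm_eq_abs, abs_mul]
      by_cases hx : x ∈ tsupport φ
      · exact mul_le_mul_of_nonneg_right (hst₁ x (hsubK hx) h hh0 hhh₁) (abs_nonneg _)
      · rw [image_eq_zero_of_notMem_tsupport hx, abs_zero, mul_zero, mul_zero]
    -- (6) `|∫ g (stencil of φ) - h² A| ≤ 2 card M vol(K) ε h²`
    have e6 : |(∫ x, g x * (∑ i, (φ (x + h • b i) + φ (x - h • b i) - 2 * φ x))) - h ^ 2 * A| ≤
        2 * Fintype.card ι * M * volume.real K * (ε * h ^ 2) := by
      have hITs : Integrable fun x =>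
          g x * (∑ i, (φ (x + h • b i) + φ (x - h • b i) - 2 * φ x)) := by
        simp_rw [lhs]; exact integrable_finsetSum _ fun i _ => hIL i
      rw [hA, ← integral_const_mul, ← integral_sub hITs (hIΔ.const_mul _)]
      have hzero : ∀ x, x ∉ K → g x * (∑ i, (φ (x + h • b i) + φ (x - h • b i) - 2 * φ x)) -
          h ^ 2 * (g x * (Δ φ) x) = 0 := by
        intro x hx
        have hx' : x ∉ tsupport φ := fun h' => hx (hsubK h')
        rw [hΔφ0 x hx', image_eq_zero_of_notMem_tsupport hx']
        simp only [mul_zero, sub_zero]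
        rw [Finset.sum_eq_zero fun i _ => ?_, mul_zero]
        rw [hout x hx _ (hhb i), sub_eq_add_neg x, hout x hx _ (by rw [norm_neg]; exact hhb i)]
        ring
      rw [← setIntegral_eq_integral_of_forall_compl_eq_zero (s := K) fun x hx => hzero x hx,
        ← Real.norm_eq_abs]
      refine (norm_setIntegral_le_of_norm_le_const (C := 2 * Fintype.card ι * M * (ε * h ^ 2))
        hK.measure_lt_top fun x hx => ?_).trans (le_of_eq (by ring))
      rw [Real.norm_eq_abs, ← mul_assoc, mul_comm (h ^ 2) (g x), mul_assoc, ← mul_sub, abs_mul]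
      have hstφ := abs_stencil_sub_laplacian_le b (F := φ) (x := x) (h := h) (ω := ε)
        (fun i σ _ => hφ2.contDiffAt) (fun i σ hσ => ?_)
      · calc |g x| * |∑ i, (φ (x + h • b i) + φ (x - h • b i) - 2 * φ x) - h ^ 2 * (Δ φ) x|
            ≤ M * (2 * Fintype.card ι * (h ^ 2 * ε)) :=
              mul_le_mul (hM x hx) hstφ (abs_nonneg _) hM0
          _ = 2 * Fintype.card ι * M * (ε * h ^ 2) := by ring
      · -- uniform continuity of `D²φ`
        have hd : dist (x + σ • h • b i) x < h₂ := by
          rw [dist_eq_norm, add_sub_cancel_left, norm_smul, norm_smul, hn1, mul_one,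
            Real.norm_eq_abs, Real.norm_eq_abs, abs_of_pos hh0]
          have : |σ| ≤ 1 := abs_le.2 ⟨hσ.1, hσ.2⟩
          nlinarith
        have h1 := hD2 hd
        rw [dist_eq_norm] at h1
        rw [← sub_apply]
        refine (le_of_eq (Real.norm_eq_abs _).symm).trans
          ((ContinuousMultilinearMap.le_opNorm _ _).trans ?_)
        have hprod : ∏ j, ‖(![b i, b i] : Fin 2 → ℝ³) j‖ = 1 := by simp [Fin.prod_univ_two, hn1]
        rw [hprod, mul_one]
        exact h1.le
    -- (7) combine
    have e7 : h ^ 2 * |A| ≤ h ^ 2 * (ε * C₀) := by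
      have hh2 : 0 < h ^ 2 := by positivity
      calc h ^ 2 * |A| = |h ^ 2 * A| := by rw [abs_mul, abs_of_pos hh2]
        _ ≤ |h ^ 2 * A - ∫ x, g x * (∑ i, (φ (x + h • b i) + φ (x - h • b i) - 2 * φ x))| +
              |∫ x, g x * (∑ i, (φ (x + h • b i) + φ (x - h • b i) - 2 * φ x))| := by
            have := abs_add_le (h ^ 2 * A - ∫ x, g x * (∑ i, (φ (x + h • b i) +
              φ (x - h • b i) - 2 * φ x))) (∫ x, g x * (∑ i, (φ (x + h • b i) +
              φ (x - h • b i) - 2 * φ x)))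
            rwa [sub_add_cancel] at this
        _ ≤ 2 * Fintype.card ι * M * volume.real K * (ε * h ^ 2) + ε * h ^ 2 * ∫ x, |φ x| := by
            rw [abs_sub_comm]; refine add_le_add e6 ?_; rw [sbp]; exact e5
        _ = h ^ 2 * (ε * C₀) := by rw [hC₀]; ring
    exact le_of_mul_le_mul_left e7 (by positivity)
  -- conclude `A = 0`
  rcases (abs_nonneg A).eq_or_lt with h0 | hpos
  · exact abs_eq_zero.1 h0.symm
  · exfalso
    have h1 := key (|A| / (2 * (C₀ + 1))) (by positivity)
    have h2 : |A| / (2 * (C₀ + 1)) * C₀ ≤ |A| / 2 := by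
      rw [div_mul_eq_mul_div, div_le_div_iff₀ (by positivity) (by positivity)]
      nlinarith [abs_nonneg A]
    linarith

/-- **Harmonicity is transported by translations**: `HarmonicAt g (u - v) → HarmonicAt (g ∘ (· - v)) u`
(any finite-dimensional real inner product space). [folklore] -/
theorem harmonicAt_comp_sub_const {F : Type*} [NormedAddCommGroup F] [InnerProductSpace ℝ F]
    [FiniteDimensional ℝ F] {g : F → ℝ} {u : F} (v : F) (hg : HarmonicAt g (u - v)) :
    HarmonicAt (fun x => g (x - v)) u := by
  refine ⟨hg.1.comp u (contDiffAt_id.sub contDiffAt_const), ?_⟩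
  have hΔ : ∀ x, (Δ (fun x => g (x - v))) x = (Δ g) (x - v) := fun x => by
    rw [laplacian_eq_iteratedFDeriv_stdOrthonormalBasis, laplacian_eq_iteratedFDeriv_stdOrthonormalBasis]
    simp only [iteratedFDeriv_comp_sub]
  have ht : Tendsto (fun x : F => x - v) (𝓝 u) (𝓝 (u - v)) :=
    (continuous_id.sub continuous_const).tendsto u
  filter_upwards [ht.eventually hg.2] with x hx
  rw [hΔ]
  exact hx

end SmallStencil

end Literature.Analysis.FluidPDE

end
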